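import Literature.NumberTheory.ModularForms.KleinForms
import Mathlib.NumberTheory.ModularForms.Discriminant
import HarnessLib

/-!
# Siegel units: the modular functions `g_a^{12} = (2πi)^{12} 𝔨_a^{12} Δ` (Kubert–Lang)

Topic `Literature/NumberTheory/ModularForms`; namespace `Literature.NumberTheory.ModularForms`.
Sequel of `KleinForms` (the Klein forms `𝔨_a(τ)`, K0–K4). For a row vector `a ∈ ℝ²` we define the
weight-`0` function

  `siegelPow a τ = (2πi)^{12} · Δ(τ) · 𝔨_a(τ)^{12}`   (`= g_a(τ)^{12}`, `g_a = 𝔨_a η²` the Siegel function)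

with Mathlib's discriminant `Δ = η^{24}` (`ModularForm.discriminant`, normalised `Δ = q∏(1−qⁿ)^{24}`),
and prove (S. Lang, *Elliptic Functions*, Ch. 19 §2; Kubert–Lang, *Modular Units*, Ch. 2 §1,
Ch. 4 §1):

* `siegelPow_smul` — **S2** (exact): `g_{a}^{12}(γτ) = g_{aγ}^{12}(τ)` for every `γ ∈ SL₂(ℤ)` (from
  K1 and the weight-`12` invariance of `Δ`, `discriminant_smul`; no multiplier);
* `siegelPow_add_intCast` — `g_{a+b}^{12} = e^{−12πi(b₀a₁ − b₁a₀)} g_a^{12}` for `b ∈ ℤ²` (K2; the sign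
  of K2 disappears in the 12th power); `siegelPow_add_fst` / `siegelPow_add_snd` (one coordinate),
  `siegelPow_add_fst_of_snd_eq_zero`: `g_{(a₀+m, 0)}^{12} = g_{(a₀,0)}^{12}`; `siegelPow_neg`:
  `g_{−a}^{12} = g_a^{12}`;
* `siegelPow_eq_qProduct` — **S1** (12th power): with `z = a₀τ + a₁`, `q_z = e^{2πiz}`,
  `g_a^{12}(τ) = q · e^{12πi(a₀−1)z} (1 − q_z)^{12} (∏_{n≥1} (1 − qⁿq_z)(1 − qⁿ/q_z))^{12}`
  (with `discriminant_eq_cexp_mul_tprod`: `Δ = q∏(1 − qⁿ)^{24}`);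
* `siegelPow_ne_zero` — no zeros on `ℍ` when `a₀ ∉ ℤ` (Lang, Ch. 19 §2, Thm. 2).

and, for a level `N ≥ 1` and `b ∈ ℤ`, the functions `siegelLevel N b z = g_{(b/N, 0)}^{12}(Nz)` on `ℍ`
(the units behind the weight-two Eisenstein series `E₂^{𝟙,ψ}`):

* `siegelLevel_add_mul`, `siegelLevel_congr`, `siegelLevel_neg` — dependence on `±b mod N` only;
  `siegelLevel_ne_zero` (`N ∤ b`);
* `gamma0Conj`, `mulNat_smul` — `N·(gz) = g^{(N)}·(Nz)` with `g^{(N)} = (α, Nβ; γ/N, δ) ∈ SL₂(ℤ)` for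
  `g = (α β; γ δ)`, `N ∣ γ`;
* `siegelLevel_smul` — for such `g`:
  `siegelLevel N b (g z) = e^{12πi (bβ)(bα/N)} · siegelLevel N (bα) z` (the units are permuted by
  `Γ₀(N)` through `b ↦ αb` up to an explicit `N`-th root of unity; `Γ₁(N)`-semi-invariance).

Everything is proved; the definitions have bodies; no named facts.

## References

* [Lang1987] S. Lang, *Elliptic Functions*, 2nd ed., GTM 112 (1987), Ch. 19 §2 (Siegel functions
  S1, S2, Thm. 2).
* [KubertLang1981] D. S. Kubert, S. Lang, *Modular Units*, Grundlehren 244 (1981), Ch. 2 §1 (K1–K4),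
  Ch. 4 §1 (Thm. 1.2, Thm. 1.3: units on `X(N)`).
-/

noncomputable section

open Complex
open UpperHalfPlane hiding I
open scoped Real MatrixGroups ModularForm

namespace Literature.NumberTheory.ModularForms

/-! ### `g_a^{12} = (2πi)^{12} Δ 𝔨_a^{12}` -/

/-- **The 12th power of the Siegel function**: `g_a(τ)^{12} = (2πi)^{12} Δ(τ) 𝔨_a(τ)^{12}` (Lang,
*Elliptic Functions*, Ch. 19 §2: `g_a = 𝔨_aΔ^{1/12}` with `Δ^{1/12} = η²` normalised as
`2πi q^{1/12}∏(1−qⁿ)²`; Mathlib's `Δ = η^{24}` is `q∏(1−qⁿ)^{24}`, whence the factor `(2πi)^{12}`).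
[cite: Lang1987, Ch. 19 §2] [cite: KubertLang1981, Ch. 2 §1] -/
def siegelPow (a : Fin 2 → ℝ) (τ : ℍ) : ℂ :=
  (2 * π * I) ^ 12 * ModularForm.discriminant τ * kleinFormH a τ ^ 12

/-- Unfolding lemma. [cite: Lang1987, Ch. 19 §2] -/
theorem siegelPow_def (a : Fin 2 → ℝ) (τ : ℍ) :
    siegelPow a τ = (2 * π * I) ^ 12 * ModularForm.discriminant τ * kleinFormH a τ ^ 12 := rfl

/-- `Δ(γτ) = (cτ + d)^{12} Δ(τ)` for `γ ∈ SL₂(ℤ)` (Mathlib's level-one cusp form `Δ`). [folklore] -/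
theorem discriminant_smul (γ : SL(2, ℤ)) (τ : ℍ) :
    ModularForm.discriminant (γ • τ) =
      (((γ 1 0 : ℤ) : ℂ) * τ + ((γ 1 1 : ℤ) : ℂ)) ^ 12 * ModularForm.discriminant τ := by
  have hΓ1 : SlashInvariantFormClass (CuspForm 𝒮ℒ 12) (CongruenceSubgroup.Gamma 1) 12 :=
    CongruenceSubgroup.Gamma_one_coe_eq_SL ▸
      (inferInstance : SlashInvariantFormClass (CuspForm 𝒮ℒ 12) 𝒮ℒ 12)
  have h := SlashInvariantForm.slash_action_eqn_SL'' CuspForm.discriminant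
    (CongruenceSubgroup.mem_Gamma_one γ) τ
  rw [CuspForm.coe_discriminant, ModularGroup.denom_apply] at h
  rw [h, zpow_ofNat]

/-- The algebra behind S2: `c¹²(j¹²D)(j⁻¹K)¹² = c¹²DK¹²` for `j ≠ 0`. [folklore] -/
private theorem smul_algebra (c j D K : ℂ) (hj : j ≠ 0) :
    c ^ 12 * (j ^ 12 * D) * (j⁻¹ * K) ^ 12 = c ^ 12 * D * K ^ 12 := by
  field_simp

/-- **S2 (exact transformation under `SL₂(ℤ)`)**: `g_a^{12}(γτ) = g_{aγ}^{12}(τ)`, `aγ` the row vector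
`(a₀a + a₁c, a₀b + a₁d)` (Lang, *Elliptic Functions*, Ch. 19 §2, S2: "`g_{aα}(τ) = g_a(ατ)`", from K1
and the weight `12` of `Δ`; for the 12th powers there is no root of unity). [cite: Lang1987, Ch. 19 §2, S2] -/
theorem siegelPow_smul (a : Fin 2 → ℝ) (γ : SL(2, ℤ)) (τ : ℍ) :
    siegelPow a (γ • τ) = siegelPow ![a 0 * γ 0 0 + a 1 * γ 1 0, a 0 * γ 0 1 + a 1 * γ 1 1] τ := by
  have hj0 : ((γ 1 0 : ℤ) : ℂ) * τ + ((γ 1 1 : ℤ) : ℂ) ≠ 0 := sl_denom_ne_zero γ τ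
  rw [siegelPow_def, siegelPow_def, discriminant_smul, kleinFormH_smul]
  exact smul_algebra _ _ _ _ hj0

/-- `((−1)^k)^{12} = 1` for every integer `k`. [folklore] -/
theorem neg_one_zpow_pow_twelve (k : ℤ) : ((-1 : ℂ) ^ k) ^ 12 = 1 := by
  rcases Int.even_or_odd k with h | h
  · rw [h.neg_one_zpow, one_pow]
  · rw [h.neg_one_zpow]; norm_num

/-- **K2 for the 12th powers**: `g_{a+b}^{12}(τ) = e^{−12πi(b₀a₁ − b₁a₀)} g_a^{12}(τ)` for `b ∈ ℤ²`
(the sign `(−1)^{b₀+b₁+b₀b₁}` of K2 disappears). [cite: Lang1987, Ch. 19 §1, K2] -/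
theorem siegelPow_add_intCast (a : Fin 2 → ℝ) (b : Fin 2 → ℤ) (τ : ℍ) :
    siegelPow (fun i => a i + b i) τ =
      cexp (-(12 * (π * I * (b 0 * a 1 - b 1 * a 0)))) * siegelPow a τ := by
  rw [siegelPow_def, siegelPow_def, kleinFormH_add_intCast]
  have hE : cexp (-(π * I * (b 0 * a 1 - b 1 * a 0))) ^ 12 =
      cexp (-(12 * (π * I * (b 0 * a 1 - b 1 * a 0)))) := by
    rw [← Complex.exp_nat_mul]; congr 1; push_cast; ring
  have key : ∀ (c D s E K E' : ℂ), s ^ 12 = 1 → E ^ 12 = E' →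
      c * D * (s * E * K) ^ 12 = E' * (c * D * K ^ 12) := by
    intro c D s E K E' hs hE'
    rw [mul_pow, mul_pow, hs, hE']; ring
  exact key _ _ _ _ _ _ (neg_one_zpow_pow_twelve _) hE

/-- Translation in the first coordinate: `g_{(a₀ + m, a₁)}^{12} = e^{−12πima₁} g_a^{12}`.
[cite: Lang1987, Ch. 19 §1, K2] -/
theorem siegelPow_add_fst (a : Fin 2 → ℝ) (m : ℤ) (τ : ℍ) :
    siegelPow ![a 0 + m, a 1] τ = cexp (-(12 * (π * I * (m * a 1)))) * siegelPow a τ := by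
  have h := siegelPow_add_intCast a ![m, 0] τ
  have e : (fun i => a i + ((![m, 0] : Fin 2 → ℤ) i : ℝ)) = ![a 0 + m, a 1] := by
    ext i; fin_cases i <;> simp
  rw [e] at h
  rw [h]
  congr 2
  simp

/-- Translation in the second coordinate: `g_{(a₀, a₁ + n)}^{12} = e^{12πina₀} g_a^{12}`.
[cite: Lang1987, Ch. 19 §1, K2] -/
theorem siegelPow_add_snd (a : Fin 2 → ℝ) (n : ℤ) (τ : ℍ) :
    siegelPow ![a 0, a 1 + n] τ = cexp (12 * (π * I * (n * a 0))) * siegelPow a τ := by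
  have h := siegelPow_add_intCast a ![0, n] τ
  have e : (fun i => a i + ((![0, n] : Fin 2 → ℤ) i : ℝ)) = ![a 0, a 1 + n] := by
    ext i; fin_cases i <;> simp
  rw [e] at h
  rw [h]
  congr 2
  simp

/-- In particular `g_{(a₀ + m, 0)}^{12} = g_{(a₀, 0)}^{12}`: the function `g_{(a₀,0)}^{12}` only depends on
`a₀ mod 1`. [cite: Lang1987, Ch. 19 §2, Remarks] -/
theorem siegelPow_add_fst_of_snd_eq_zero (a₀ : ℝ) (m : ℤ) (τ : ℍ) :
    siegelPow ![a₀ + m, 0] τ = siegelPow ![a₀, 0] τ := by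
  have h := siegelPow_add_fst ![a₀, 0] m τ
  simpa using h

/-! ### The `q`-product (S1) and non-vanishing -/

open Literature.NumberTheory.EllipticCurves (multipliable_one_sub_pow_succ_mul
  multipliable_inv_one_sub_pow_sq tprod_quot_eq)

/-- `Δ(τ) = q ∏_{n ≥ 0} (1 − q^{n+1})^{24}`, `q = e^{2πiτ}` (Mathlib's `discriminant_eq_q_prod`).
[folklore] -/
theorem discriminant_eq_cexp_mul_tprod (τ : ℍ) :
    ModularForm.discriminant τ =
      cexp (2 * π * I * τ) * ∏' n : ℕ, (1 - cexp (2 * π * I * τ) ^ (n + 1)) ^ 24 := by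
  have h := ModularForm.discriminant_eq_q_prod τ
  have h1 : Function.Periodic.qParam 1 (τ : ℂ) = cexp (2 * π * I * τ) := by
    rw [Function.Periodic.qParam]; congr 1; push_cast; ring
  have h2 : ∀ n : ℕ, ModularForm.eta_q n τ = cexp (2 * π * I * τ) ^ (n + 1) := fun n =>
    ModularForm.eta_q_eq_pow n τ
  simp_rw [h1, h2] at h
  exact h

/-- `1 − q^{n+1} ≠ 0` for `‖q‖ < 1`. [folklore] -/
theorem one_sub_pow_succ_ne_zero' {q : ℂ} (hq : ‖q‖ < 1) (n : ℕ) : (1 : ℂ) - q ^ (n + 1) ≠ 0 := by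
  refine sub_ne_zero.mpr (Ne.symm fun h => ?_)
  have hlt : ‖q ^ (n + 1)‖ < 1 := by
    rw [norm_pow]; exact pow_lt_one₀ (norm_nonneg _) hq n.succ_ne_zero
  rw [h, norm_one] at hlt
  exact lt_irrefl _ hlt

/-- `∏ (1 − q^{n+1})^{24} · (∏ ((1 − q^{n+1})²)⁻¹)^{12} = 1` for `‖q‖ < 1`. [folklore] -/
theorem tprod_pow_mul_tprod_inv_sq_pow {q : ℂ} (hq : ‖q‖ < 1) :
    (∏' n : ℕ, (1 - q ^ (n + 1)) ^ 24) * (∏' n : ℕ, ((1 - q ^ (n + 1)) ^ 2)⁻¹) ^ 12 = 1 := by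
  have hD : Multipliable fun n : ℕ => ((1 - q ^ (n + 1)) ^ 2)⁻¹ := multipliable_inv_one_sub_pow_sq hq
  have h1 : Multipliable fun n : ℕ => 1 - q ^ (n + 1) :=
    (multipliable_one_sub_pow_succ_mul hq 1).congr fun n => by simp
  have h24 : Multipliable fun n : ℕ => (1 - q ^ (n + 1)) ^ 24 := h1.pow 24
  rw [← hD.tprod_pow, ← h24.tprod_mul (hD.pow 12)]
  have hterm : ∀ n : ℕ, (1 - q ^ (n + 1)) ^ 24 * (((1 - q ^ (n + 1)) ^ 2)⁻¹) ^ 12 = 1 := fun n => by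
    have hne := one_sub_pow_succ_ne_zero' hq n
    field_simp
  simp_rw [hterm]
  exact tprod_one

/-- The algebra behind S1: with `T·D⁻¹² = 1` and `c ≠ 0`,
`c¹²(qT)(−(1/c)·E·v·(P·D))¹² = q·E¹²·v¹²·P¹²`. [folklore] -/
private theorem qProduct_algebra (c q T D E v P : ℂ) (hc : c ≠ 0) (hT : T * D ^ 12 = 1) :
    c ^ 12 * (q * T) * (-(1 / c) * E * v * (P * D)) ^ 12 = q * E ^ 12 * v ^ 12 * P ^ 12 := by
  have h1 : c ^ 12 * (1 / c) ^ 12 = 1 := by field_simp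
  calc c ^ 12 * (q * T) * (-(1 / c) * E * v * (P * D)) ^ 12
      = (c ^ 12 * (1 / c) ^ 12) * (T * D ^ 12) * (q * E ^ 12 * v ^ 12 * P ^ 12) := by ring
    _ = q * E ^ 12 * v ^ 12 * P ^ 12 := by rw [h1, hT]; ring

/-- **S1 (the `q`-product of `g_a^{12}`)**: with `q = e^{2πiτ}`, `z = a₀τ + a₁`, `q_z = e^{2πiz}`,
`g_a(τ)^{12} = q · e^{12πi(a₀−1)z} (1 − q_z)^{12} (∏_{n≥1} (1 − qⁿq_z)(1 − qⁿ/q_z))^{12}`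
(Lang, *Elliptic Functions*, Ch. 19 §2, S1: "`g_a(τ) = −q^{(1/2)B₂(a₁)} e^{2πia₂(a₁−1)/2}(1 − q_z)
∏(1 − qⁿq_z)(1 − qⁿ/q_z)`"; here `q^{6B₂(a₀)}e^{12πia₁(a₀−1)} = q·e^{12πi(a₀−1)z}`). From K4 and
Mathlib's `Δ = q∏(1 − qⁿ)^{24}` (`ModularForm.discriminant_eq_q_prod`). [cite: Lang1987, Ch. 19 §2, S1]
[cite: KubertLang1981, Ch. 2 §1, K4] -/
theorem siegelPow_eq_qProduct (a : Fin 2 → ℝ) (τ : ℍ) :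
    siegelPow a τ =
      cexp (2 * π * I * τ) * cexp (12 * (π * I * (a 0 - 1) * ((a 0 : ℂ) * τ + a 1))) *
        (1 - cexp (2 * π * I * ((a 0 : ℂ) * τ + a 1))) ^ 12 *
        (∏' n : ℕ, ((1 - cexp (2 * π * I * τ) ^ (n + 1) * cexp (2 * π * I * ((a 0 : ℂ) * τ + a 1))) *
          (1 - cexp (2 * π * I * τ) ^ (n + 1) * (cexp (2 * π * I * ((a 0 : ℂ) * τ + a 1)))⁻¹))) ^ 12 := by
  have hq1 : ‖cexp (2 * π * I * τ)‖ < 1 := UpperHalfPlane.norm_exp_two_pi_I_lt_one τ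
  have hpi : (2 * π * I : ℂ) ≠ 0 := by simp [Real.pi_ne_zero, Complex.I_ne_zero]
  have hE : cexp (π * I * (a 0 - 1) * ((a 0 : ℂ) * τ + a 1)) ^ 12 =
      cexp (12 * (π * I * (a 0 - 1) * ((a 0 : ℂ) * τ + a 1))) := by
    rw [← Complex.exp_nat_mul]; push_cast; ring_nf
  rw [siegelPow_def, discriminant_eq_cexp_mul_tprod, kleinFormH_eq_qProduct, tprod_quot_eq hq1,
    qProduct_algebra _ _ _ _ _ _ _ hpi (tprod_pow_mul_tprod_inv_sq_pow hq1), hE]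

/-- `a₀τ + a₁ ∈ ℤτ + ℤ` forces `a₀ ∈ ℤ`. [folklore] -/
theorem exists_int_eq_of_mem_lattice {a : Fin 2 → ℝ} {τ : ℍ}
    (h : (a 0 : ℂ) * τ + a 1 ∈ (PeriodPair.ofUpperHalfPlane τ).lattice) : ∃ m : ℤ, a 0 = m := by
  obtain ⟨m, n, hmn⟩ := PeriodPair.mem_lattice.mp h
  simp only [PeriodPair.ofUpperHalfPlane_ω₁, PeriodPair.ofUpperHalfPlane_ω₂, mul_one] at hmn
  have him := congrArg Complex.im hmn
  simp only [Complex.add_im, Complex.mul_im, Complex.intCast_re, Complex.intCast_im, zero_mul,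
    add_zero, Complex.ofReal_re, Complex.ofReal_im] at him
  refine ⟨m, ?_⟩
  have hτ : (τ : ℂ).im ≠ 0 := τ.im_pos.ne'
  have := mul_right_cancel₀ hτ him
  exact_mod_cast this.symm

/-- **`g_a^{12}` has no zero on `ℍ` when `a₀ ∉ ℤ`** (Lang, *Elliptic Functions*, Ch. 19 §2, Thm. 2:
"`g_a` has no zeros or poles on the upper half plane"; the zeros of `𝔨(z; L)` are the lattice
points, and `Δ ≠ 0`). [cite: Lang1987, Ch. 19 §2, Thm. 2] -/
theorem siegelPow_ne_zero {a : Fin 2 → ℝ} (ha : ∀ m : ℤ, a 0 ≠ m) (τ : ℍ) : siegelPow a τ ≠ 0 := by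
  rw [siegelPow_def]
  refine mul_ne_zero (mul_ne_zero (pow_ne_zero _ ?_) (ModularForm.discriminant_ne_zero τ))
    (pow_ne_zero _ ?_)
  · simp [Real.pi_ne_zero, Complex.I_ne_zero]
  · rw [kleinFormH_def]
    exact (PeriodPair.ofUpperHalfPlane τ).kleinForm_ne_zero fun hmem =>
      (exists_int_eq_of_mem_lattice hmem).elim fun m hm => ha m hm

/-! ### The level-`N` functions `g_{(b/N, 0)}^{12}(Nz)` -/

/-- The point `Nz ∈ ℍ`. [folklore] -/
def mulNat (N : ℕ) [NeZero N] (z : ℍ) : ℍ :=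
  (⟨(N : ℝ), Nat.cast_pos.mpr (NeZero.pos N)⟩ : {x : ℝ // 0 < x}) • z

/-- `↑(Nz) = N·z`. [folklore] -/
@[simp] theorem coe_mulNat (N : ℕ) [NeZero N] (z : ℍ) : ((mulNat N z : ℍ) : ℂ) = (N : ℂ) * z := by
  simp [mulNat]

/-- **The level-`N` Siegel units (12th powers)** `siegelLevel N b z = g_{(b/N, 0)}^{12}(Nz)`, `b ∈ ℤ`
(Kubert–Lang, *Modular Units*, Ch. 4 §1: the units `g_a`, `a ∈ N⁻¹ℤ²`, of `X(N)`; composed with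
`z ↦ Nz` the vectors `(b/N, 0)` give functions on `Γ₁(N)`, cf. Lang Ch. 19 §2 Thm. 2).
[cite: KubertLang1981, Ch. 4 §1] [cite: Lang1987, Ch. 19 §2] -/
def siegelLevel (N : ℕ) [NeZero N] (b : ℤ) (z : ℍ) : ℂ :=
  siegelPow ![(b : ℝ) / N, 0] (mulNat N z)

/-- Unfolding lemma. [cite: KubertLang1981, Ch. 4 §1] -/
theorem siegelLevel_def (N : ℕ) [NeZero N] (b : ℤ) (z : ℍ) :
    siegelLevel N b z = siegelPow ![(b : ℝ) / N, 0] (mulNat N z) := rfl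

/-- `siegelLevel N (b + mN) = siegelLevel N b`: the function only depends on `b mod N`.
[cite: Lang1987, Ch. 19 §2, Remarks] -/
theorem siegelLevel_add_mul (N : ℕ) [NeZero N] (b m : ℤ) (z : ℍ) :
    siegelLevel N (b + m * N) z = siegelLevel N b z := by
  rw [siegelLevel_def, siegelLevel_def]
  have hN : (N : ℝ) ≠ 0 := Nat.cast_ne_zero.mpr (NeZero.ne N)
  have : ((b + m * N : ℤ) : ℝ) / N = (b : ℝ) / N + m := by push_cast; field_simp
  rw [this, siegelPow_add_fst_of_snd_eq_zero]

/-- `siegelLevel N b` has no zero on `ℍ` when `N ∤ b`. [cite: Lang1987, Ch. 19 §2, Thm. 2] -/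
theorem siegelLevel_ne_zero (N : ℕ) [NeZero N] {b : ℤ} (hb : ¬ (N : ℤ) ∣ b) (z : ℍ) :
    siegelLevel N b z ≠ 0 := by
  rw [siegelLevel_def]
  refine siegelPow_ne_zero (fun m hm => hb ?_) _
  have hN : (N : ℝ) ≠ 0 := Nat.cast_ne_zero.mpr (NeZero.ne N)
  simp only [Matrix.cons_val_zero] at hm
  rw [div_eq_iff hN] at hm
  refine ⟨m, ?_⟩
  exact_mod_cast (by rw [hm]; ring : (b : ℝ) = N * m)

/-- `siegelLevel N b` only depends on `b mod N`. [cite: Lang1987, Ch. 19 §2, Remarks] -/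
theorem siegelLevel_congr (N : ℕ) [NeZero N] {b b' : ℤ} (h : b ≡ b' [ZMOD N]) (z : ℍ) :
    siegelLevel N b z = siegelLevel N b' z := by
  obtain ⟨m, hm⟩ := (Int.modEq_iff_dvd.mp h.symm)
  have : b = b' + m * N := by linarith
  rw [this, siegelLevel_add_mul]

/-- `g_{−a}^{12} = g_a^{12}` (`𝔨_{−a} = −𝔨_a`). [cite: KubertLang1981, Ch. 2 §1, K1] -/
theorem siegelPow_neg (a : Fin 2 → ℝ) (τ : ℍ) : siegelPow (-a) τ = siegelPow a τ := by
  rw [siegelPow_def, siegelPow_def, kleinFormH_def, kleinFormH_def]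
  have : ((((-a) 0 : ℝ) : ℂ) * τ + (((-a) 1 : ℝ) : ℂ)) = -(((a 0 : ℝ) : ℂ) * τ + ((a 1 : ℝ) : ℂ)) := by
    simp only [Pi.neg_apply, Complex.ofReal_neg]; ring
  rw [this, PeriodPair.kleinForm_neg, neg_pow, show ((-1 : ℂ) ^ 12) = 1 by norm_num, one_mul]

/-- `siegelLevel N (−b) = siegelLevel N b`. [cite: KubertLang1981, Ch. 2 §1, K1] -/
theorem siegelLevel_neg (N : ℕ) [NeZero N] (b : ℤ) (z : ℍ) :
    siegelLevel N (-b) z = siegelLevel N b z := by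
  rw [siegelLevel_def, siegelLevel_def, ← siegelPow_neg]
  congr 1
  ext i; fin_cases i <;> simp [neg_div]

/-! ### Transformation under `Γ₀(N)` -/

/-- For `g = (α β; γ δ) ∈ SL₂(ℤ)` with `N ∣ γ`: the matrix `g^{(N)} := (α, Nβ; γ/N, δ) ∈ SL₂(ℤ)`,
which satisfies `N·(gz) = g^{(N)}(Nz)`. [folklore] -/
def gamma0Conj (N : ℕ) [NeZero N] (g : SL(2, ℤ)) (hg : (N : ℤ) ∣ g 1 0) : SL(2, ℤ) :=
  ⟨!![g 0 0, N * g 0 1; g 1 0 / N, g 1 1], by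
    obtain ⟨c, hc⟩ := hg
    have hN : (N : ℤ) ≠ 0 := Int.natCast_ne_zero.mpr (NeZero.ne N)
    have hdiv : g 1 0 / (N : ℤ) = c := by rw [hc, Int.mul_ediv_cancel_left _ hN]
    have hdet := Matrix.det_fin_two (g : Matrix (Fin 2) (Fin 2) ℤ)
    rw [g.det_coe] at hdet
    rw [Matrix.det_fin_two_of, hdiv]
    linear_combination -hdet + g 0 1 * hc⟩

/-- The upper-left entry `α` of `g^{(N)}`. [folklore] -/
@[simp] theorem gamma0Conj_apply_00 (N : ℕ) [NeZero N] (g : SL(2, ℤ)) (hg : (N : ℤ) ∣ g 1 0) :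
    (gamma0Conj N g hg) 0 0 = g 0 0 := rfl

/-- The upper-right entry `Nβ` of `g^{(N)}`. [folklore] -/
@[simp] theorem gamma0Conj_apply_01 (N : ℕ) [NeZero N] (g : SL(2, ℤ)) (hg : (N : ℤ) ∣ g 1 0) :
    (gamma0Conj N g hg) 0 1 = N * g 0 1 := rfl

/-- The lower-left entry `γ/N` of `g^{(N)}`. [folklore] -/
@[simp] theorem gamma0Conj_apply_10 (N : ℕ) [NeZero N] (g : SL(2, ℤ)) (hg : (N : ℤ) ∣ g 1 0) :
    (gamma0Conj N g hg) 1 0 = g 1 0 / N := rfl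

/-- The lower-right entry `δ` of `g^{(N)}`. [folklore] -/
@[simp] theorem gamma0Conj_apply_11 (N : ℕ) [NeZero N] (g : SL(2, ℤ)) (hg : (N : ℤ) ∣ g 1 0) :
    (gamma0Conj N g hg) 1 1 = g 1 1 := rfl

/-- `N·(gz) = g^{(N)}(Nz)` for `g ∈ Γ₀(N)`. [folklore] -/
theorem mulNat_smul (N : ℕ) [NeZero N] (g : SL(2, ℤ)) (hg : (N : ℤ) ∣ g 1 0) (z : ℍ) :
    mulNat N (g • z) = gamma0Conj N g hg • mulNat N z := by
  obtain ⟨c, hc⟩ := hg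
  have hN : (N : ℤ) ≠ 0 := Int.natCast_ne_zero.mpr (NeZero.ne N)
  have hNC : (N : ℂ) ≠ 0 := Nat.cast_ne_zero.mpr (NeZero.ne N)
  have hdiv : g 1 0 / (N : ℤ) = c := by rw [hc, Int.mul_ediv_cancel_left _ hN]
  have hj : ((g 1 0 : ℤ) : ℂ) * z + ((g 1 1 : ℤ) : ℂ) ≠ 0 := sl_denom_ne_zero g z
  have hj' : ((c : ℤ) : ℂ) * ((N : ℂ) * z) + ((g 1 1 : ℤ) : ℂ) ≠ 0 := by
    have : ((c : ℤ) : ℂ) * ((N : ℂ) * z) + ((g 1 1 : ℤ) : ℂ) =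
        ((g 1 0 : ℤ) : ℂ) * z + ((g 1 1 : ℤ) : ℂ) := by rw [hc]; push_cast; ring
    rwa [this]
  apply UpperHalfPlane.ext
  rw [coe_mulNat, UpperHalfPlane.coe_specialLinearGroup_apply,
    UpperHalfPlane.coe_specialLinearGroup_apply]
  simp only [gamma0Conj_apply_00, gamma0Conj_apply_01, gamma0Conj_apply_10, gamma0Conj_apply_11,
    coe_mulNat, hdiv, eq_intCast]
  rw [hc]
  push_cast
  field_simp

/-- `g_{(x, y + n)}^{12} = e^{12πinx} g_{(x,y)}^{12}` (coordinates). [cite: Lang1987, Ch. 19 §1, K2] -/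
theorem siegelPow_pair_add_snd (x y : ℝ) (n : ℤ) (τ : ℍ) :
    siegelPow ![x, y + n] τ = cexp (12 * (π * I * (n * x))) * siegelPow ![x, y] τ := by
  simpa using siegelPow_add_snd ![x, y] n τ

/-- **Transformation of the level-`N` units under `Γ₀(N)`** (Kubert–Lang, Ch. 4 §1 / Lang Ch. 19 §2,
S2 + K2): for `g = (α β; γ δ) ∈ SL₂(ℤ)` with `N ∣ γ`,
`siegelLevel N b (gz) = e^{12πi b²αβ/N} · siegelLevel N (bα) z`
(`g_{(b/N,0)}^{12}(N gz) = g_{(b/N,0)}^{12}(g^{(N)} Nz) = g_{(bα/N, bβ)}^{12}(Nz) = e^{12πi bβ·bα/N}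
g_{(bα/N,0)}^{12}(Nz)`). In particular the units are permuted by `Γ₀(N)` through `b ↦ αb` up to
`N`-th roots of unity, and `siegelLevel N b` is semi-invariant under `Γ₁(N)`.
[cite: KubertLang1981, Ch. 4 §1, Thm. 1.3] [cite: Lang1987, Ch. 19 §2, S2] -/
theorem siegelLevel_smul (N : ℕ) [NeZero N] (b : ℤ) (g : SL(2, ℤ)) (hg : (N : ℤ) ∣ g 1 0) (z : ℍ) :
    siegelLevel N b (g • z) =
      cexp (12 * (π * I * ((b * g 0 1 : ℤ) * ((b * g 0 0 : ℤ) / N : ℝ)))) *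
        siegelLevel N (b * g 0 0) z := by
  have hN : (N : ℝ) ≠ 0 := Nat.cast_ne_zero.mpr (NeZero.ne N)
  rw [siegelLevel_def, siegelLevel_def, mulNat_smul N g hg z, siegelPow_smul]
  have e : (![(b : ℝ) / N * ((gamma0Conj N g hg) 0 0 : ℤ) + (0 : ℝ) * ((gamma0Conj N g hg) 1 0 : ℤ),
      (b : ℝ) / N * ((gamma0Conj N g hg) 0 1 : ℤ) + (0 : ℝ) * ((gamma0Conj N g hg) 1 1 : ℤ)] :
        Fin 2 → ℝ) = ![((b * g 0 0 : ℤ) : ℝ) / N, 0 + ((b * g 0 1 : ℤ) : ℝ)] := by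
    ext i; fin_cases i
    · simp only [gamma0Conj_apply_00]; push_cast; simp; ring
    · simp only [gamma0Conj_apply_01]; push_cast; simp; field_simp
  have e0 : (![(b : ℝ) / N, 0] : Fin 2 → ℝ) 0 = (b : ℝ) / N := rfl
  have e1 : (![(b : ℝ) / N, 0] : Fin 2 → ℝ) 1 = 0 := rfl
  simp only [e0, e1]
  rw [e, siegelPow_pair_add_snd]

end Literature.NumberTheory.ModularForms

end
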